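import Summits.HubbardSuperconductivity.HubbardSuperconductivity.Theorems.BalabanIRBirGappedPhaseReductionTorusZeroModeClosedForm
import HarnessLib

/-!
# Route BalabanIR — crux 4 `BirGappedPhaseReduction` / 4R (items `stmt-HubbardSuperconductivity-2082`, `…-14846`):
# an EXPLICIT temporal stiffness for the zero-mode coercivity

`…TorusZeroModeCoercivity` / `…TorusZeroModeClosedForm` bound the fermionic weight of a zero-mode
pair-phase history with SOME admissible family `κ_k ≥ 0`, positive off the nodes of the gap symbol.
Here the family is made explicit. For the symbol block `h = !![ξ, D; conj D, -ξ]` (real `ξ`),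
`E = √(ξ² + ‖D‖²)`, `G = e^{-ah}` and its gauge-fixed real form `Ĝ = !![Re G₀₀, ‖G₁₀‖; ‖G₁₀‖, Re G₁₁]`:

* `gibbsWeight_symbolBlock_apply_zero_zero / _one_one`, `norm_gibbsWeight_symbolBlock_apply_one_zero`
  — the entries `cosh(aE) ∓ (sinh(aE)/E)ξ` and `|sinh(aE)|‖D‖/E`;
* `gibbsWeight_symbolBlock_diag_bounds`, `gibbsWeight_symbolBlock_offdiag_bounds` — the two-sided
  bounds `e^{-|a|E} ≤ Re G₀₀, Re G₁₁ ≤ e^{|a|E}` and `|a|‖D‖ ≤ ‖G₁₀‖ ≤ e^{|a|E}`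
  (`e^{∓|x|} = cosh x ∓ |sinh x|`, `|x| ≤ sinh |x|`);
* `admissible_of_four_mul_le` — `4κx ≤ y ∧ 4κy ≤ x ⇒ κ(x+y)² ≤ xy`;
* **`explicitStiffness_admissible`** — the EXPLICIT constant
  `κ₀ = ¼ e^{-2|a|E} · min(e^{-2|a|E}, a²‖D‖²)` satisfies the four conditional-variance
  inequalities of `…TemporalCoercivity` for `Ĝ` (`κ₀ > 0` iff `a ≠ 0 ∧ D ≠ 0`; for small gaps
  `κ₀ ≈ ¼ a²‖D‖²` — a temporal stiffness `∝ (aΔ)²`);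
* **`norm_trace_prod_gibbsWeight_bdgTorus_phase_le_explicit`** — the Fock-level zero-mode bound of
  the torus reference with this explicit family and the closed forms of `…ClosedForm`:
  `‖Tr ∏_t e^{-aH_BdG(η, e^{iθ_t}Δ, μ)}‖ ≤ |e^{-a(2n+2)|Λ|(η 0 - μ)}| · ∏_k (2 + 2cosh((2n+2)aE_k) · e^{-(κ₀(k)/2) Σ_t (1 - cos(θ_{t+1} - θ_t))})`,
  `κ₀(k) = ¼ e^{-2|a|E_k} min(e^{-2|a|E_k}, a²‖Δ̂ k‖²)`, `E_k = √((Re η̂′ k)² + ‖Δ̂ k‖²)` — so the total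
  temporal stiffness `Σ_k κ₀(k)/2` is explicitly EXTENSIVE: at least
  `#{k : ‖Δ̂ k‖ ≥ d₀, E_k ≤ E₁} · ⅛ e^{-2|a|E₁} min(e^{-2|a|E₁}, a²d₀²)`.

`Theses`-free, no definitions; `--supports` the crux. [folklore]
-/

noncomputable section

namespace Summit.HubbardSuperconductivity.HubbardSuperconductivity.Theorems

namespace BirBdG

open Matrix NormedSpace Literature.Probability.LatticeModels Literature.MathematicalPhysics.QuantumLattice
open scoped ComplexConjugate ComplexOrder

section ExplicitStiffness

/-- Admissibility from two one-sided comparisons: `4κx ≤ y`, `4κy ≤ x` (`x, y, κ ≥ 0`) give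
`κ(x+y)² ≤ xy`. [folklore] -/
theorem admissible_of_four_mul_le {x y κ : ℝ} (hx : 0 ≤ x) (hy : 0 ≤ y) (hκ : 0 ≤ κ)
    (h1 : 4 * κ * x ≤ y) (h2 : 4 * κ * y ≤ x) : κ * (x + y) ^ 2 ≤ x * y := by
  -- `16 κ² xy ≤ xy`, hence `κ ≤ 1/4` unless `xy = 0`
  rcases eq_or_lt_of_le hx with hx0 | hxpos
  · subst hx0
    have : κ * y = 0 := by nlinarith
    nlinarith
  rcases eq_or_lt_of_le hy with hy0 | hypos
  · subst hy0
    have : κ * x = 0 := by nlinarith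
    nlinarith
  have hκ4 : κ ≤ 1 / 4 := by
    have h := mul_le_mul h1 h2 (by positivity) hy
    -- (4κx)(4κy) ≤ y x
    have hxy : 0 < x * y := mul_pos hxpos hypos
    nlinarith
  nlinarith [mul_nonneg hκ hx, mul_nonneg hκ hy]

/-! #### Entries of the symbol-block Gibbs weight and their two-sided bounds -/

/-- The `(0,0)` entry: `cosh(aE) - (sinh(aE)/E) ξ`. [folklore] -/
theorem gibbsWeight_symbolBlock_apply_zero_zero (ξ : ℝ) (D : ℂ) (a : ℝ) (hE : ξ ^ 2 + ‖D‖ ^ 2 ≠ 0) :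
    Matrix.gibbsWeight a (!![(ξ : ℂ), D; star D, -(ξ : ℂ)] : Matrix (Fin 2) (Fin 2) ℂ) 0 0 =
      ((Real.cosh (a * Real.sqrt (ξ ^ 2 + ‖D‖ ^ 2)) -
        Real.sinh (a * Real.sqrt (ξ ^ 2 + ‖D‖ ^ 2)) / Real.sqrt (ξ ^ 2 + ‖D‖ ^ 2) * ξ : ℝ) : ℂ) := by
  rw [gibbsWeight_symbolBlock ξ D a hE]
  simp

/-- The `(1,1)` entry: `cosh(aE) + (sinh(aE)/E) ξ`. [folklore] -/
theorem gibbsWeight_symbolBlock_apply_one_one (ξ : ℝ) (D : ℂ) (a : ℝ) (hE : ξ ^ 2 + ‖D‖ ^ 2 ≠ 0) :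
    Matrix.gibbsWeight a (!![(ξ : ℂ), D; star D, -(ξ : ℂ)] : Matrix (Fin 2) (Fin 2) ℂ) 1 1 =
      ((Real.cosh (a * Real.sqrt (ξ ^ 2 + ‖D‖ ^ 2)) +
        Real.sinh (a * Real.sqrt (ξ ^ 2 + ‖D‖ ^ 2)) / Real.sqrt (ξ ^ 2 + ‖D‖ ^ 2) * ξ : ℝ) : ℂ) := by
  rw [gibbsWeight_symbolBlock ξ D a hE]
  simp

/-- The modulus of the pair-hopping entry: `|sinh(aE)|/E · ‖D‖`. [folklore] -/
theorem norm_gibbsWeight_symbolBlock_apply_one_zero (ξ : ℝ) (D : ℂ) (a : ℝ) (hE : ξ ^ 2 + ‖D‖ ^ 2 ≠ 0) :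
    ‖Matrix.gibbsWeight a (!![(ξ : ℂ), D; star D, -(ξ : ℂ)] : Matrix (Fin 2) (Fin 2) ℂ) 1 0‖ =
      |Real.sinh (a * Real.sqrt (ξ ^ 2 + ‖D‖ ^ 2))| / Real.sqrt (ξ ^ 2 + ‖D‖ ^ 2) * ‖D‖ := by
  rw [gibbsWeight_symbolBlock_apply_one_zero ξ D a hE, norm_neg, norm_mul, norm_star,
    Complex.norm_real, Real.norm_eq_abs, abs_div, abs_of_nonneg (Real.sqrt_nonneg _)]

/-- `e^{-|x|} = cosh x - |sinh x|`. [folklore] -/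
theorem exp_neg_abs_eq_cosh_sub_abs_sinh (x : ℝ) : Real.exp (-|x|) = Real.cosh x - |Real.sinh x| := by
  rw [← Real.cosh_sub_sinh, Real.cosh_abs, Real.abs_sinh]

/-- `e^{|x|} = cosh x + |sinh x|`. [folklore] -/
theorem exp_abs_eq_cosh_add_abs_sinh (x : ℝ) : Real.exp |x| = Real.cosh x + |Real.sinh x| := by
  rw [← Real.cosh_add_sinh, Real.cosh_abs, Real.abs_sinh]

/-- For `|t| ≤ 1`: `e^{-|x|} ≤ cosh x - sinh x · t ≤ e^{|x|}`. [folklore] -/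
theorem exp_neg_abs_le_cosh_sub_sinh_mul {x t : ℝ} (ht : |t| ≤ 1) :
    Real.exp (-|x|) ≤ Real.cosh x - Real.sinh x * t ∧ Real.cosh x - Real.sinh x * t ≤ Real.exp |x| := by
  rw [exp_neg_abs_eq_cosh_sub_abs_sinh, exp_abs_eq_cosh_add_abs_sinh]
  have h : |Real.sinh x * t| ≤ |Real.sinh x| := by
    rw [abs_mul]
    exact mul_le_of_le_one_right (abs_nonneg _) ht
  constructor <;> linarith [(abs_le.mp h).1, (abs_le.mp h).2]

/-- **Two-sided bounds on the diagonal entries**: `e^{-|a|E} ≤ Re G₀₀, Re G₁₁ ≤ e^{|a|E}` for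
`G = e^{-ah}`, `E = √(ξ² + ‖D‖²)`. [folklore] -/
theorem gibbsWeight_symbolBlock_diag_bounds (ξ : ℝ) (D : ℂ) (a : ℝ) :
    Real.exp (-(|a| * Real.sqrt (ξ ^ 2 + ‖D‖ ^ 2))) ≤
        (Matrix.gibbsWeight a (!![(ξ : ℂ), D; star D, -(ξ : ℂ)] : Matrix (Fin 2) (Fin 2) ℂ) 0 0).re ∧
      (Matrix.gibbsWeight a (!![(ξ : ℂ), D; star D, -(ξ : ℂ)] : Matrix (Fin 2) (Fin 2) ℂ) 0 0).re ≤
        Real.exp (|a| * Real.sqrt (ξ ^ 2 + ‖D‖ ^ 2)) ∧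
      Real.exp (-(|a| * Real.sqrt (ξ ^ 2 + ‖D‖ ^ 2))) ≤
        (Matrix.gibbsWeight a (!![(ξ : ℂ), D; star D, -(ξ : ℂ)] : Matrix (Fin 2) (Fin 2) ℂ) 1 1).re ∧
      (Matrix.gibbsWeight a (!![(ξ : ℂ), D; star D, -(ξ : ℂ)] : Matrix (Fin 2) (Fin 2) ℂ) 1 1).re ≤
        Real.exp (|a| * Real.sqrt (ξ ^ 2 + ‖D‖ ^ 2)) := by
  by_cases hE : ξ ^ 2 + ‖D‖ ^ 2 = 0
  · have hξ : ξ = 0 := by nlinarith [sq_nonneg ξ, sq_nonneg ‖D‖]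
    have hD : D = 0 := norm_eq_zero.mp (by nlinarith [sq_nonneg ξ, sq_nonneg ‖D‖, norm_nonneg D])
    subst hξ hD
    have h0 : (!![((0 : ℝ) : ℂ), 0; star 0, -((0 : ℝ) : ℂ)] : Matrix (Fin 2) (Fin 2) ℂ) = 0 := by
      ext i j
      fin_cases i <;> fin_cases j <;> simp
    rw [h0, Matrix.gibbsWeight, smul_zero, NormedSpace.exp_zero]
    simp
  set E : ℝ := Real.sqrt (ξ ^ 2 + ‖D‖ ^ 2) with hEdef
  have hEpos : 0 < E := Real.sqrt_pos.mpr (lt_of_le_of_ne (by positivity) (Ne.symm hE))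
  have hξE : |ξ| ≤ E := by
    rw [hEdef, ← Real.sqrt_sq_eq_abs]
    exact Real.sqrt_le_sqrt (by nlinarith [norm_nonneg D])
  have ht : |ξ / E| ≤ 1 := by
    rw [abs_div, abs_of_pos hEpos, div_le_one hEpos]
    exact hξE
  have ht' : |(-(ξ / E))| ≤ 1 := by rwa [abs_neg]
  have haE : |a * E| = |a| * E := by rw [abs_mul, abs_of_pos hEpos]
  have h00 := exp_neg_abs_le_cosh_sub_sinh_mul (x := a * E) ht
  have h11 := exp_neg_abs_le_cosh_sub_sinh_mul (x := a * E) ht'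
  rw [haE] at h00 h11
  rw [gibbsWeight_symbolBlock_apply_zero_zero ξ D a hE, gibbsWeight_symbolBlock_apply_one_one ξ D a hE,
    Complex.ofReal_re, Complex.ofReal_re, ← hEdef]
  refine ⟨?_, ?_, ?_, ?_⟩
  · convert h00.1 using 1; ring
  · convert h00.2 using 1; ring
  · convert h11.1 using 1; ring
  · convert h11.2 using 1; ring

/-- **Bounds on the pair-hopping modulus**: `|a|·‖D‖ ≤ ‖G₁₀‖ ≤ e^{|a|E}`. [folklore] -/
theorem gibbsWeight_symbolBlock_offdiag_bounds (ξ : ℝ) (D : ℂ) (a : ℝ) :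
    |a| * ‖D‖ ≤ ‖Matrix.gibbsWeight a (!![(ξ : ℂ), D; star D, -(ξ : ℂ)] : Matrix (Fin 2) (Fin 2) ℂ) 1 0‖ ∧
      ‖Matrix.gibbsWeight a (!![(ξ : ℂ), D; star D, -(ξ : ℂ)] : Matrix (Fin 2) (Fin 2) ℂ) 1 0‖ ≤
        Real.exp (|a| * Real.sqrt (ξ ^ 2 + ‖D‖ ^ 2)) := by
  by_cases hE : ξ ^ 2 + ‖D‖ ^ 2 = 0
  · have hξ : ξ = 0 := by nlinarith [sq_nonneg ξ, sq_nonneg ‖D‖]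
    have hD : D = 0 := norm_eq_zero.mp (by nlinarith [sq_nonneg ξ, sq_nonneg ‖D‖, norm_nonneg D])
    subst hξ hD
    have h0 : (!![((0 : ℝ) : ℂ), 0; star 0, -((0 : ℝ) : ℂ)] : Matrix (Fin 2) (Fin 2) ℂ) = 0 := by
      ext i j
      fin_cases i <;> fin_cases j <;> simp
    rw [h0, Matrix.gibbsWeight, smul_zero, NormedSpace.exp_zero]
    simp
  set E : ℝ := Real.sqrt (ξ ^ 2 + ‖D‖ ^ 2) with hEdef
  have hEpos : 0 < E := Real.sqrt_pos.mpr (lt_of_le_of_ne (by positivity) (Ne.symm hE))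
  have hDE : ‖D‖ ≤ E := by
    have h := Real.abs_le_sqrt (show ‖D‖ ^ 2 ≤ ξ ^ 2 + ‖D‖ ^ 2 by nlinarith [sq_nonneg ξ])
    rwa [abs_of_nonneg (norm_nonneg D), ← hEdef] at h
  have haE : |a * E| = |a| * E := by rw [abs_mul, abs_of_pos hEpos]
  rw [norm_gibbsWeight_symbolBlock_apply_one_zero ξ D a hE, ← hEdef]
  constructor
  · -- `|a| ‖D‖ ≤ |sinh(aE)|/E ‖D‖` from `|aE| ≤ sinh |aE|`
    have h1 : |a| * E ≤ |Real.sinh (a * E)| := by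
      rw [Real.abs_sinh, ← haE]
      exact Real.self_le_sinh_iff.mpr (abs_nonneg _)
    have h2 : |a| ≤ |Real.sinh (a * E)| / E := by
      rw [le_div_iff₀ hEpos]
      exact h1
    exact mul_le_mul_of_nonneg_right h2 (norm_nonneg D)
  · -- `|sinh(aE)|/E ‖D‖ ≤ |sinh(aE)| ≤ e^{|a|E}`
    have h1 : |Real.sinh (a * E)| / E * ‖D‖ ≤ |Real.sinh (a * E)| := by
      rw [div_mul_eq_mul_div, div_le_iff₀ hEpos]
      exact mul_le_mul_of_nonneg_left hDE (abs_nonneg _)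
    have h2 : |Real.sinh (a * E)| ≤ Real.exp (|a| * E) := by
      rw [← haE, exp_abs_eq_cosh_add_abs_sinh]
      linarith [Real.cosh_pos (a * E)]
    exact h1.trans h2

/-- **An explicit admissible temporal stiffness.** For the gauge-fixed symbol-block Gibbs weight
`Ĝ = !![Re G₀₀, ‖G₁₀‖; ‖G₁₀‖, Re G₁₁]`, `G = e^{-ah}`, `h = !![ξ, D; conj D, -ξ]`, `E = √(ξ² + ‖D‖²)`,
the EXPLICIT constant `κ₀ = ¼ e^{-2|a|E} · min(e^{-2|a|E}, a²‖D‖²)` is admissible (satisfies the four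
conditional-variance inequalities of `…TemporalCoercivity`); `κ₀ > 0` iff `a ≠ 0` and `D ≠ 0`; for
small gaps `κ₀ ≈ ¼ a²‖D‖² e^{-2|a|E}` — temporal stiffness `∝ (aΔ)²`. [folklore] -/
theorem explicitStiffness_admissible (ξ : ℝ) (D : ℂ) (a : ℝ) (Gr : Matrix (Fin 2) (Fin 2) ℝ)
    (hGr : Gr = !![(Matrix.gibbsWeight a (!![(ξ : ℂ), D; star D, -(ξ : ℂ)] : Matrix (Fin 2) (Fin 2) ℂ) 0 0).re,
          ‖Matrix.gibbsWeight a (!![(ξ : ℂ), D; star D, -(ξ : ℂ)] : Matrix (Fin 2) (Fin 2) ℂ) 1 0‖;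
        ‖Matrix.gibbsWeight a (!![(ξ : ℂ), D; star D, -(ξ : ℂ)] : Matrix (Fin 2) (Fin 2) ℂ) 1 0‖,
          (Matrix.gibbsWeight a (!![(ξ : ℂ), D; star D, -(ξ : ℂ)] : Matrix (Fin 2) (Fin 2) ℂ) 1 1).re])
    (b b' : Fin 2) :
    Real.exp (-(2 * |a| * Real.sqrt (ξ ^ 2 + ‖D‖ ^ 2))) *
          min (Real.exp (-(2 * |a| * Real.sqrt (ξ ^ 2 + ‖D‖ ^ 2)))) (a ^ 2 * ‖D‖ ^ 2) / 4 *
        (Gr b 0 * Gr 0 b' + Gr b 1 * Gr 1 b') ^ 2 ≤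
      (Gr b 0 * Gr 0 b') * (Gr b 1 * Gr 1 b') := by
  obtain ⟨hA1, hA2, hC1, hC2⟩ := gibbsWeight_symbolBlock_diag_bounds ξ D a
  obtain ⟨hB1, hB2⟩ := gibbsWeight_symbolBlock_offdiag_bounds ξ D a
  set E : ℝ := Real.sqrt (ξ ^ 2 + ‖D‖ ^ 2) with hEdef
  set A : ℝ := (Matrix.gibbsWeight a (!![(ξ : ℂ), D; star D, -(ξ : ℂ)] : Matrix (Fin 2) (Fin 2) ℂ) 0 0).re
  set C : ℝ := (Matrix.gibbsWeight a (!![(ξ : ℂ), D; star D, -(ξ : ℂ)] : Matrix (Fin 2) (Fin 2) ℂ) 1 1).re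
  set B : ℝ := ‖Matrix.gibbsWeight a (!![(ξ : ℂ), D; star D, -(ξ : ℂ)] : Matrix (Fin 2) (Fin 2) ℂ) 1 0‖
  set q : ℝ := Real.exp (-(|a| * E)) with hq
  have hq2 : Real.exp (-(2 * |a| * E)) = q ^ 2 := by
    rw [hq, ← Real.exp_nat_mul]; congr 1; push_cast; ring
  have hqinv : Real.exp (|a| * E) = q⁻¹ := by rw [hq, Real.exp_neg, inv_inv]
  rw [hqinv] at hA2 hC2 hB2
  rw [hq2]
  have hqpos : 0 < q := Real.exp_pos _
  have hq1 : q ≤ 1 := by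
    rw [hq, Real.exp_le_one_iff, neg_nonpos]
    exact mul_nonneg (abs_nonneg a) (Real.sqrt_nonneg _)
  have hApos : 0 < A := hqpos.trans_le hA1
  have hCpos : 0 < C := hqpos.trans_le hC1
  have hB0 : 0 ≤ B := norm_nonneg _
  -- `A, C ≤ 1/q`, `B ≤ 1/q` as products
  have hAq : A * q ≤ 1 := by rw [← le_div_iff₀ hqpos, one_div]; exact hA2
  have hCq : C * q ≤ 1 := by rw [← le_div_iff₀ hqpos, one_div]; exact hC2
  have hBq : B * q ≤ 1 := by rw [← le_div_iff₀ hqpos, one_div]; exact hB2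
  set m : ℝ := min (q ^ 2) (a ^ 2 * ‖D‖ ^ 2) with hm
  have hm0 : 0 ≤ m := le_min (sq_nonneg q) (by positivity)
  have hm1 : m ≤ q ^ 2 := min_le_left _ _
  have hm2 : m ≤ a ^ 2 * ‖D‖ ^ 2 := min_le_right _ _
  have hmB : m ≤ B ^ 2 := hm2.trans (by
    have h := pow_le_pow_left₀ (by positivity) hB1 2
    rwa [mul_pow, sq_abs] at h)
  have hκ0 : 0 ≤ q ^ 2 * m / 4 := by positivity
  -- the four cases
  have hq3 : q ^ 3 ≤ q := pow_le_of_le_one hqpos.le hq1 (by norm_num)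
  have key_diag : ∀ {X : ℝ}, q ≤ X → X * q ≤ 1 →
      q ^ 2 * m / 4 * (X * X + B * B) ^ 2 ≤ (X * X) * (B * B) := by
    intro X hX1 hXq
    have hXpos : 0 < X := hqpos.trans_le hX1
    have hXq0 : 0 ≤ X * q := by positivity
    have hXq2 : X * q * (X * q) ≤ 1 := by nlinarith [mul_le_mul hXq hXq hXq0 zero_le_one]
    have hBq0 : 0 ≤ B * q := by positivity
    have hBq2 : B * q * (B * q) ≤ 1 := by nlinarith [mul_le_mul hBq hBq hBq0 zero_le_one]
    have hqX2 : q * q ≤ X * X := mul_self_le_mul_self hqpos.le hX1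
    refine admissible_of_four_mul_le (mul_self_nonneg X) (mul_self_nonneg B) hκ0 ?_ ?_
    · -- 4κ X² = m (Xq)² ≤ m ≤ B²
      calc 4 * (q ^ 2 * m / 4) * (X * X) = m * (X * q * (X * q)) := by ring
        _ ≤ m * 1 := mul_le_mul_of_nonneg_left hXq2 hm0
        _ ≤ B * B := by rw [mul_one, ← sq]; exact hmB
    · -- 4κ B² = q² m B² ≤ q² (Bq)² ≤ q² ≤ X²
      calc 4 * (q ^ 2 * m / 4) * (B * B) = m * (B * B) * (q * q) := by ring
        _ ≤ q ^ 2 * (B * B) * (q * q) := by gcongr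
        _ = q * q * (B * q * (B * q)) := by ring
        _ ≤ q * q * 1 := mul_le_mul_of_nonneg_left hBq2 (mul_self_nonneg q)
        _ ≤ X * X := by rw [mul_one]; exact hqX2
  have key_off : ∀ {X Y : ℝ}, q ≤ X → X * q ≤ 1 → q ≤ Y → Y * q ≤ 1 →
      q ^ 2 * m / 4 * (X * B + B * Y) ^ 2 ≤ (X * B) * (B * Y) := by
    intro X Y hX1 hXq hY1 hYq
    have hXpos : 0 < X := hqpos.trans_le hX1
    have hYpos : 0 < Y := hqpos.trans_le hY1
    refine admissible_of_four_mul_le (by positivity) (by positivity) hκ0 ?_ ?_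
    · -- q² m X B ≤ q⁴ X B = q³ (Xq) B ≤ q³ B ≤ q B ≤ Y B
      calc 4 * (q ^ 2 * m / 4) * (X * B) = m * (X * B) * (q * q) := by ring
        _ ≤ q ^ 2 * (X * B) * (q * q) := by gcongr
        _ = q ^ 3 * B * (X * q) := by ring
        _ ≤ q ^ 3 * B * 1 := mul_le_mul_of_nonneg_left hXq (by positivity)
        _ ≤ q * B * 1 := by gcongr
        _ ≤ Y * B * 1 := by gcongr
        _ = B * Y := by ring
    · calc 4 * (q ^ 2 * m / 4) * (B * Y) = m * (B * Y) * (q * q) := by ring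
        _ ≤ q ^ 2 * (B * Y) * (q * q) := by gcongr
        _ = q ^ 3 * B * (Y * q) := by ring
        _ ≤ q ^ 3 * B * 1 := mul_le_mul_of_nonneg_left hYq (by positivity)
        _ ≤ q * B * 1 := by gcongr
        _ ≤ X * B * 1 := by gcongr
        _ = X * B := by ring
  have hG00 : Gr 0 0 = A := by rw [hGr]; rfl
  have hG01 : Gr 0 1 = B := by rw [hGr]; rfl
  have hG10 : Gr 1 0 = B := by rw [hGr]; rfl
  have hG11 : Gr 1 1 = C := by rw [hGr]; rfl
  fin_cases b <;> fin_cases b'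
  · simp only [Fin.zero_eta, Fin.isValue, hG00, hG01, hG10]
    exact key_diag hA1 hAq
  · simp only [Fin.zero_eta, Fin.isValue, Fin.mk_one, hG00, hG01, hG11]
    exact key_off hA1 hAq hC1 hCq
  · simp only [Fin.zero_eta, Fin.isValue, Fin.mk_one, hG00, hG10, hG11]
    have h := key_off hC1 hCq hA1 hAq
    convert h using 1 <;> ring
  · simp only [Fin.isValue, Fin.mk_one, hG10, hG01, hG11]
    have h := key_diag hC1 hCq
    convert h using 1 <;> ring

variable {Λ : Type*} [LinearOrder Λ] [Fintype Λ] {L : ℕ} [NeZero L]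

/-- **Zero-mode temporal coercivity with EXPLICIT stiffness (no existential).** In the setting of
`…TorusZeroModeClosedForm.exists_coercive_norm_trace_prod_gibbsWeight_bdgTorus_phase_le_cosh`, for
every even number `2n+2` of slices and every closed history of global pair phases,
`‖Tr ∏_t e^{-aH_BdG(η, e^{iθ_t}Δ, μ)}‖ ≤ |e^{-a(2n+2)|Λ|(η 0 - μ)}| · ∏_k (2 + 2cosh((2n+2)aE_k) · e^{-(κ₀(k)/2) Σ_t (1 - cos(θ_{t+1} - θ_t))})`
with the explicit `κ₀(k) = ¼ e^{-2|a|E_k} min(e^{-2|a|E_k}, a²‖Δ̂ k‖²)`, `E_k = √((Re η̂′ k)² + ‖Δ̂ k‖²)`: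
summed over the modes with `‖Δ̂ k‖ ≥ d₀`, `E_k ≤ E₁` this is an explicit EXTENSIVE temporal stiffness
`≥ #{such k} · ¼ e^{-2|a|E₁} min(e^{-2|a|E₁}, a²d₀²)`. [folklore] -/
theorem norm_trace_prod_gibbsWeight_bdgTorus_phase_le_explicit (e : Λ ≃ TorusSite 2 L)
    (η Δv : TorusSite 2 L → ℂ) (hη : ∀ r, η (-r) = η r) (hΔ : ∀ r, Δv (-r) = Δv r) (μ a : ℝ)
    (hreal : ∀ k, star (torusFourier (fun r => η r - if r = 0 then (μ : ℂ) else 0) k) =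
      torusFourier (fun r => η r - if r = 0 then (μ : ℂ) else 0) k)
    {n : ℕ} (θ : Fin (2 * n + 2) → ℝ) :
    ‖((List.ofFn fun t => Matrix.gibbsWeight a
        (bdgBondHamiltonian (fun u v => η (e u - e v))
          (fun u v => Complex.exp (Complex.I * θ t) * (-(1 / 2 : ℂ) * star (Δv (e u - e v)))) μ)).prod).trace‖ ≤
      ‖Complex.exp (-(a : ℂ) * ∑ _t : Fin (2 * n + 2), ∑ _x : Λ, (η 0 - μ))‖ *
        ∏ k : TorusSite 2 L, (2 + 2 * Real.cosh ((2 * n + 2) * a *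
            Real.sqrt ((torusFourier (fun r => η r - if r = 0 then (μ : ℂ) else 0) k).re ^ 2 +
              ‖torusFourier Δv k‖ ^ 2)) *
          Real.exp (-(Real.exp (-(2 * |a| * Real.sqrt ((torusFourier (fun r => η r - if r = 0 then (μ : ℂ)
                else 0) k).re ^ 2 + ‖torusFourier Δv k‖ ^ 2))) *
              min (Real.exp (-(2 * |a| * Real.sqrt ((torusFourier (fun r => η r - if r = 0 then (μ : ℂ)
                else 0) k).re ^ 2 + ‖torusFourier Δv k‖ ^ 2)))) (a ^ 2 * ‖torusFourier Δv k‖ ^ 2) / 4 / 2 *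
            ∑ t : Fin (2 * n + 2), (1 - Real.cos (θ (t + 1) - θ t))))) := by
  have hξ : ∀ k, (((torusFourier (fun r => η r - if r = 0 then (μ : ℂ) else 0) k).re : ℝ) : ℂ) =
      torusFourier (fun r => η r - if r = 0 then (μ : ℂ) else 0) k := fun k =>
    Complex.conj_eq_iff_re.mp (hreal k)
  have hh : ∀ k, (!![torusFourier (fun r => η r - if r = 0 then (μ : ℂ) else 0) k, torusFourier Δv k;
      star (torusFourier Δv k), -torusFourier (fun r => η r - if r = 0 then (μ : ℂ) else 0) k] :
      Matrix (Fin 2) (Fin 2) ℂ).IsHermitian := fun k => isHermitian_symbolBlock (hreal k)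
  refine (norm_trace_prod_gibbsWeight_bdgTorus_phase_le e η Δv hη hΔ μ a hreal _ (fun k => rfl)
    (fun k => Real.exp (-(2 * |a| * Real.sqrt ((torusFourier (fun r => η r - if r = 0 then (μ : ℂ)
        else 0) k).re ^ 2 + ‖torusFourier Δv k‖ ^ 2))) *
      min (Real.exp (-(2 * |a| * Real.sqrt ((torusFourier (fun r => η r - if r = 0 then (μ : ℂ)
        else 0) k).re ^ 2 + ‖torusFourier Δv k‖ ^ 2)))) (a ^ 2 * ‖torusFourier Δv k‖ ^ 2) / 4)
    (fun k => by positivity) (fun k b b' => ?_) θ).trans_eq ?_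
  · -- admissibility of the explicit family at mode `k`
    have h := explicitStiffness_admissible (torusFourier (fun r => η r - if r = 0 then (μ : ℂ) else 0) k).re
      (torusFourier Δv k) a _ rfl b b'
    rw [hξ k] at h
    exact h
  · congr 1
    refine Finset.prod_congr rfl fun k _ => ?_
    -- `det Ĝ_k = 1` and `tr (Ĝ_k²)^{n+1} = 2cosh((2n+2)aE_k)`
    have hdet : ((!![(Matrix.gibbsWeight a (!![torusFourier (fun r => η r - if r = 0 then (μ : ℂ) else 0) k,
            torusFourier Δv k; star (torusFourier Δv k),
            -torusFourier (fun r => η r - if r = 0 then (μ : ℂ) else 0) k] : Matrix (Fin 2) (Fin 2) ℂ) 0 0).re,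
          ‖Matrix.gibbsWeight a (!![torusFourier (fun r => η r - if r = 0 then (μ : ℂ) else 0) k,
            torusFourier Δv k; star (torusFourier Δv k),
            -torusFourier (fun r => η r - if r = 0 then (μ : ℂ) else 0) k] : Matrix (Fin 2) (Fin 2) ℂ) 1 0‖;
        ‖Matrix.gibbsWeight a (!![torusFourier (fun r => η r - if r = 0 then (μ : ℂ) else 0) k,
            torusFourier Δv k; star (torusFourier Δv k),
            -torusFourier (fun r => η r - if r = 0 then (μ : ℂ) else 0) k] : Matrix (Fin 2) (Fin 2) ℂ) 1 0‖,
          (Matrix.gibbsWeight a (!![torusFourier (fun r => η r - if r = 0 then (μ : ℂ) else 0) k,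
            torusFourier Δv k; star (torusFourier Δv k),
            -torusFourier (fun r => η r - if r = 0 then (μ : ℂ) else 0) k] : Matrix (Fin 2) (Fin 2) ℂ) 1 1).re] :
          Matrix (Fin 2) (Fin 2) ℝ)).det = 1 := by
      have h1 := det_gaugeFix_eq (isHermitian_gibbsWeight a (hh k))
      have h2 : (Matrix.gibbsWeight a (!![torusFourier (fun r => η r - if r = 0 then (μ : ℂ) else 0) k,
          torusFourier Δv k; star (torusFourier Δv k),
          -torusFourier (fun r => η r - if r = 0 then (μ : ℂ) else 0) k] : Matrix (Fin 2) (Fin 2) ℂ)).det = 1 := by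
        rw [← hξ k]
        exact det_gibbsWeight_symbolBlock_eq_one _ (torusFourier Δv k) a
      rw [h2] at h1
      exact_mod_cast h1
    have htr := trace_gaugeFix_gibbsWeight_symbolBlock_pow
      (torusFourier (fun r => η r - if r = 0 then (μ : ℂ) else 0) k).re (torusFourier Δv k) a (2 * n + 2)
    rw [hξ] at htr
    rw [hdet, abs_one, one_pow, one_add_one_eq_two, ← pow_two, ← pow_mul,
      show 2 * (n + 1) = 2 * n + 2 by ring, htr]
    push_cast
    ring

end ExplicitStiffness

end BirBdG

end Summit.HubbardSuperconductivity.HubbardSuperconductivity.Theorems
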